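import Literature.Barriers.RiemannHypothesis.SubsetPrimeTowers

/-!
# S3♯ corollary: a QUASI-criterion of the sub-ℙ shape forces `¬RH ∧ quasi-RH(α)` (barrier record, appendix)

An appendix to the barrier record S3♯ (`Literature/Barriers/RiemannHypothesis/SubsetPrimeTowers.lean`,
`subPrimeFiniteTowerBlind_holds`), (s)-class, 0 toward RH: an INSTRUMENT, not a route.  Everything here is
PROVED (no named fact, no sorry); the parent module is imported and cited BY NAME, never patched.
## The sentence
`SubPrimeQuasiCriterion α` is the would-be QUASI-criterion of the S3♯ data shape at abscissa `α`: «every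
multiplicity-one sub-sequence `P` of ℙ (`P.prime j = q_{f j}`, `f` strictly increasing) with thin complement
(`ψ − ψ_P ≤ K x^{2/3}`), `N_P(x) = a x + O(x^θ)` for some `θ ∈ (2α/(α+2), 1/2)`, `a > 0`, and a holomorphic
continuation `Z` of `ζ_P` to `{Re s > θ} ∖ {1}` has `Z ≠ 0` on `α ≤ Re s < 1`».  For `1/2 < α < 2/3`,
`SubPrimeQuasiCriterion.forces`: such a criterion would DISPROVE RH (under RH the BDR §5 intermediate system
`ℙ ∖ 𝒫_𝒮`, `exists_keptSystem_window_zero_of_riemannHypothesis`, satisfies the data with `Z(α) = 0`) and PROVE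
quasi-RH(α) (at `P = ℙ`, `f = id`, `Z = ζ`).  So the landed S3♯ dichotomy does not refute quasi-criteria
outright — the world «quasi-RH(α) ∧ ¬RH» has no witness by name — but it PRICES them: proving one settles RH
negatively.  (Residual (r3) of the S3♯ header, the `α`-corollary half; the full three-world version needs
Littlewood-type bounds for `ζ'/ζ` under a zero-free half-plane and is not attempted.)
HONEST LABEL: barrier record appendix, (s), 0 toward RH; nothing here bears on the truth of RH.

## References
* [BrouckeDebruyneRevesz2023] F. Broucke, G. Debruyne, Sz. Gy. Révész, *Some examples of well-behaved Beurling
  number systems*, arXiv:2309.01567, Trans. AMS (2024), §5 pp. 15–17 (held; §5 PROVED in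
  `Literature/NumberTheory/BeurlingPrimes/`, assembled in the parent module).
-/

noncomputable section

namespace Literature.Barriers.RiemannHypothesis

open Set Complex Literature.NumberTheory.BeurlingPrimes Literature.NumberTheory.LFunctions

/-- The would-be QUASI-criterion of the S3♯ data shape at abscissa `α`: «every multiplicity-one sub-sequence of ℙ
with thin complement, `N_P(x) = a x + O(x^θ)` for some `θ ∈ (2α/(α+2), 1/2)`, `a > 0`, and a continuation `Z` of
`ζ_P` to `{Re s > θ} ∖ {1}` has `Z` zero-free on `α ≤ Re s < 1`».  At `P = ℙ` this is quasi-RH(α).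
[cite: BrouckeDebruyneRevesz2023, §5 pp. 15–17] -/
def SubPrimeQuasiCriterion (α : ℝ) : Prop :=
  ∀ (P : BeurlingPrimes) (f : ℕ → ℕ) (a θ : ℝ) (Z : ℂ → ℂ), StrictMono f →
    (∀ j : ℕ, P.prime j = (ratPrime (f j) : ℝ)) →
    (∃ K : ℝ, ∀ x : ℝ, 1 ≤ x → ratPrimes.chebyshevPsi x - P.chebyshevPsi x ≤ K * x ^ (2 / 3 : ℝ)) →
    0 < a → 2 * α / (α + 2) < θ → θ < 1 / 2 → P.IntErrorLE a θ → P.IsZetaContinuation θ Z →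
    ∀ s : ℂ, α ≤ s.re → s.re < 1 → Z s ≠ 0

/-- **The `α`-corollary of S3♯.** A valid quasi-criterion at abscissa `α ∈ (1/2, 2/3)` would DISPROVE RH (RH ⇒ the
BDR kept system has `Z(α) = 0` inside the window) and PROVE quasi-RH(α) (at `P = ℙ`): it forces the world
«`¬RH` ∧ `ζ ≠ 0` on `α ≤ Re s < 1`». [cite: BrouckeDebruyneRevesz2023, §5 pp. 15–17] -/
theorem SubPrimeQuasiCriterion.forces {α : ℝ} (hα : 1 / 2 < α) (hα23 : α < 2 / 3)
    (h : SubPrimeQuasiCriterion α) :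
    ¬ RiemannHypothesis ∧ ∀ s : ℂ, riemannZeta s = 0 → α ≤ s.re → s.re < 1 → False := by
  have hα2 : (0 : ℝ) < α + 2 := by linarith
  have hwin : 2 * α / (α + 2) < 1 / 2 := by
    rw [div_lt_iff₀ hα2]; linarith
  set θ : ℝ := (2 * α / (α + 2) + 1 / 2) / 2 with hθdef
  have hθlo : 2 * α / (α + 2) < θ := by rw [hθdef]; linarith
  have hθhi : θ < 1 / 2 := by rw [hθdef]; linarith
  have hwin0 : 0 < 2 * α / (α + 2) := div_pos (by linarith) hα2
  have hθ0 : 0 ≤ θ := by linarith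
  have hαw : α / 2 ≤ 2 * α / (α + 2) := by
    rw [le_div_iff₀ hα2]; nlinarith
  have hαθ : α / 2 ≤ θ := by linarith
  refine ⟨fun hRH ↦ ?_, fun s hζ hlo hhi ↦ ?_⟩
  · obtain ⟨S, hT, a, Z, ha, ⟨K, hK⟩, hN', hZ1, hZd, hZα⟩ :=
      exists_keptSystem_window_zero_of_riemannHypothesis hRH hα hα23
    obtain ⟨C, hC⟩ := hN' (θ - 2 * α / (α + 2)) (sub_pos.2 hθlo)
    refine h (keptSystem S hT) (Nat.nth (fun i ↦ i ∈ keptIdx S)) a θ Z ?_ (fun j ↦ rfl) ⟨|K|, fun x hx ↦ ?_⟩ ha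
      hθlo hθhi ⟨C, fun x hx ↦ ?_⟩ ?_ (α : ℂ) (by simp) (by simp only [ofReal_re]; linarith) hZα
    · exact Nat.nth_strictMono (by simpa [Set.setOf_mem_eq] using hT)
    · have hx0 : 0 ≤ x ^ α := Real.rpow_nonneg (by linarith) _
      calc ratPrimes.chebyshevPsi x - (keptSystem S hT).chebyshevPsi x ≤ K * x ^ α := hK x hx
        _ ≤ |K| * x ^ α := mul_le_mul_of_nonneg_right (le_abs_self K) hx0
        _ ≤ |K| * x ^ (2 / 3 : ℝ) :=
          mul_le_mul_of_nonneg_left (Real.rpow_le_rpow_of_exponent_le hx (by linarith)) (abs_nonneg K)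
    · have h' := hC x hx
      rwa [show 2 * α / (α + 2) + (θ - 2 * α / (α + 2)) = θ by ring] at h'
    · exact (BeurlingPrimes.isZetaContinuation_iff _ _ _).2
        ⟨hZ1, hZd.mono fun s hs ↦ ⟨by linarith [hs.1], hs.2⟩⟩
  · refine h ratPrimes id 1 θ riemannZeta strictMono_id (fun j ↦ rfl) ⟨0, fun x _ ↦ by simp⟩ one_pos hθlo hθhi
      (ratPrimes_intErrorLE hθ0) ?_ s hlo hhi hζ
    exact (BeurlingPrimes.isZetaContinuation_iff _ _ _).2
      ⟨fun s hs ↦ (zeta_ratPrimes hs).symm, fun s hs ↦ (differentiableAt_riemannZeta hs.2).differentiableWithinAt⟩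

end Literature.Barriers.RiemannHypothesis
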